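import Summits.Ventures.QEC.Thresholds.ToricCodeHGPThresholds
import Summits.Ventures.QEC.Thresholds.HypergraphProductGallager34Thresholds
import Literature.InformationTheory.QuantumCodes.DepolarizingCSSDecoding
import HarnessLib

/-!
# Certified DEPOLARIZING-noise thresholds for CSS families decoded sector-wise:
# `p_c^depol ≥ (3/2)·min(p₀^X, p₀^Z)`; toric codes (as HGP) `> .0427`, `(3,4)`-Gallager HGP class `> .0103`

Venture QEC, `Summits/Ventures/QEC/Thresholds/` (LADDER-QEC rung Q5, PARTITION row 09 "noise models: i.i.d.
depolarising"; qec-type-09 gen 3). Every certified threshold of the cell so far is for ONE error type (independent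
bit flips or phase flips of rate `p`, "code capacity"), erasures, or the phenomenological model. This file adds the
i.i.d. DEPOLARIZING channel (each qubit suffers `X`, `Y`, `Z` with probability `p/3` each, `PauliNoise.lean`) for CSS
codes decoded SECTOR-WISE (a decoder `DX` of the `Z`-syndrome on the bit-flip part, a decoder `DZ` of the `X`-syndrome
on the phase-flip part; success iff both residuals are stabilizer parts), packaging the Literature theorem
`CSSCode.depolarizingFailureProb_le` (`DepolarizingCSSDecoding.lean`: the two marginals of a depolarizing error are
INDEPENDENT flips of rate `2p/3`, so `P^depol_fail(p) ≤ P^X_fail(2p/3) + P^Z_fail(2p/3)`):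

* `depolarizingFailureFamily C DX DZ` — the family `i ↦ p ↦ (C i).depolarizingFailureProb (DX i) (DZ i) p`;
* `depolarizingFailureFamily_le` — `≤ xFailureFamily C DX i (2p/3) + zFailureFamily C DZ i (2p/3)`;
* `depolarizing_isThresholdLowerBound` — if `p₀^X` and `p₀^Z` (`min ≤ 2/3`) are certified sector thresholds then
  `(3/2)·min(p₀^X, p₀^Z)` is a certified depolarizing threshold (for `p < (3/2)min`, `2p/3` is below both);
* instances: `css_depolarizing_isThresholdLowerBound_of_rowWeight` (every CSS family, checks of BOTH kinds of
  weight `≤ w`, both sector distances `≥ d i`, `|Q i|·r^{d i} → 0`, every pair of minimum-weight decoder families: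
  `(3/2)·p₀(w-1)`); the toric codes as hypergraph products `toricHGP_depolarizing_isThresholdLowerBound`
  (`(3/2)·p₀(3) = (3-2√2)/4 ≈ .0429`, UNCONDITIONAL; decimal `toricHGP_depolarizing_accuracyThreshold_gt : .0427 < p_c`);
  the `(3,4)`-Gallager HGP class `gallager34_depolarizing_isThresholdLowerBound` (`(3/2)·p₀(6) ≈ .0105` modulo the
  family growth hypothesis; decimal `.0103`).

HONEST FRAMING: UNCONDITIONAL theorems (kernel axioms, no named fact, no `native_decide`) about the stated decoder
class — sector-wise minimum-weight decoding, which IGNORES the `X`/`Z` correlation of `Y` errors; the factor `3/2`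
is the exact marginal rate conversion, not an optimal-decoder statement (numerical depolarizing thresholds of the
toric code, `≈ .189` optimal / `≈ .15` MWPM, are VALIDATED-column numbers and are not claimed here).

## References

* [DennisEtAl2002] E. Dennis, A. Kitaev, A. Landahl, J. Preskill, J. Math. Phys. 43 (2002) 4452, §4.1 (error models;
  X and Z errors corrected separately), §5.3 (p₀(ν)).
* [DumerKovalevPryadko2015] I. Dumer, A. A. Kovalev, L. P. Pryadko, PRL 115 (2015) 050502, eq.
  (succesful-decoding-depolarizing), Thm 2.
* [AliferisGottesmanPreskill2006] P. Aliferis, D. Gottesman, J. Preskill, QIC 6 (2006) 97, §8.3 (depolarizing channel).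
-/

noncomputable section

namespace Summit.Ventures.QEC.Thresholds

open Filter Topology Finset Matrix
open Literature.InformationTheory.QuantumCodes
open Literature.InformationTheory.Coding (minDist)

variable {RX RZ Q : ℕ → Type*}

/-! ### The depolarizing failure family and the `3/2` rule -/

/-- **Depolarizing failure family**: failure probability of sector-wise decoding (`DX i` on bit flips, `DZ i` on
phase flips) of the `i`-th code under i.i.d. depolarizing noise of rate `p`.
[cite: DumerKovalevPryadko2015, eq. (succesful-decoding-depolarizing)] -/
def depolarizingFailureFamily [∀ i, Fintype (Q i)] [∀ i, DecidableEq (Q i)] [∀ i, Fintype (RX i)]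
    [∀ i, Fintype (RZ i)] (C : ∀ i, CSSCode (RX i) (RZ i) (Q i))
    (DX : ∀ i, Decoder (RZ i → ZMod 2) (Q i → ZMod 2)) (DZ : ∀ i, Decoder (RX i → ZMod 2) (Q i → ZMod 2)) :
    ℕ → ℝ → ℝ :=
  fun i p => (C i).depolarizingFailureProb (DX i) (DZ i) p

/-- **`P^depol(p) ≤ P^X(2p/3) + P^Z(2p/3)`** in the cell's family vocabulary (`0 ≤ p ≤ 1`).
[cite: DennisEtAl2002, §4.1 (the two error types handled separately)] -/
theorem depolarizingFailureFamily_le [∀ i, Fintype (Q i)] [∀ i, DecidableEq (Q i)] [∀ i, Fintype (RX i)]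
    [∀ i, Fintype (RZ i)] (C : ∀ i, CSSCode (RX i) (RZ i) (Q i))
    (DX : ∀ i, Decoder (RZ i → ZMod 2) (Q i → ZMod 2)) (DZ : ∀ i, Decoder (RX i → ZMod 2) (Q i → ZMod 2))
    (i : ℕ) {p : ℝ} (hp0 : 0 ≤ p) (hp1 : p ≤ 1) :
    depolarizingFailureFamily C DX DZ i p ≤
      xFailureFamily C DX i (2 * p / 3) + zFailureFamily C DZ i (2 * p / 3) :=
  (C i).depolarizingFailureProb_le (DX i) (DZ i) hp0 hp1

/-- **The `3/2` rule**: certified sector thresholds `p₀^X` (bit flips, decoders `DX`) and `p₀^Z` (phase flips,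
decoders `DZ`), `min(p₀^X, p₀^Z) ≤ 2/3`, give the certified DEPOLARIZING threshold `(3/2)·min(p₀^X, p₀^Z)` for sector-wise
decoding by `(DX, DZ)`. UNCONDITIONAL. [cite: DennisEtAl2002, §4.1 (depolarizing channel vs. independent X/Z errors)] -/
theorem depolarizing_isThresholdLowerBound [∀ i, Fintype (Q i)] [∀ i, DecidableEq (Q i)] [∀ i, Fintype (RX i)]
    [∀ i, Fintype (RZ i)] (C : ∀ i, CSSCode (RX i) (RZ i) (Q i))
    (DX : ∀ i, Decoder (RZ i → ZMod 2) (Q i → ZMod 2)) (DZ : ∀ i, Decoder (RX i → ZMod 2) (Q i → ZMod 2))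
    {pX pZ : ℝ} (hX : IsThresholdLowerBound (xFailureFamily C DX) pX)
    (hZ : IsThresholdLowerBound (zFailureFamily C DZ) pZ) (hmin : min pX pZ ≤ 2 / 3) :
    IsThresholdLowerBound (depolarizingFailureFamily C DX DZ) (3 / 2 * min pX pZ) := by
  intro p hp0 hp
  have hpX' : 2 * p / 3 < pX := by
    have := min_le_left pX pZ
    linarith
  have hpZ' : 2 * p / 3 < pZ := by
    have := min_le_right pX pZ
    linarith
  have hp1 : p ≤ 1 := by linarith
  have h23 : 0 ≤ 2 * p / 3 := by positivity
  have hsum : Tendsto (fun i => xFailureFamily C DX i (2 * p / 3) + zFailureFamily C DZ i (2 * p / 3))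
      atTop (𝓝 0) := by
    have h := (hX (2 * p / 3) h23 hpX').add (hZ (2 * p / 3) h23 hpZ')
    rw [add_zero] at h
    exact h
  refine squeeze_zero (fun i => ?_) (fun i => depolarizingFailureFamily_le C DX DZ i hp0 hp1) hsum
  exact (C i).depolarizingFailureProb_nonneg (DX i) (DZ i) hp0 hp1

/-- `p₀(ν) ≤ 1/2 ≤ 2/3`: every `thresholdValue` qualifies for the `3/2` rule. [cite: DennisEtAl2002, §5.3 eq. (p_c_2d)] -/
theorem thresholdValue_le_two_thirds (ν : ℝ) : thresholdValue ν ≤ 2 / 3 :=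
  (thresholdValue_le_half ν).trans (by norm_num)

/-! ### Every CSS LDPC family: `(3/2)·p₀(w-1)` -/

/-- **Depolarizing threshold `≥ (3/2)·p₀(w-1)` for every CSS LDPC family decoded sector-wise by minimum weight**:
`X`-checks AND `Z`-checks of weight `≤ w` (`w ≥ 2`), every `Z`-logical and every `X`-logical of the `i`-th code of
weight `≥ d i ≥ 1`, `|Q i|·r^{d i} → 0` for `0 < r < 1`, ANY pair of minimum-weight decoder families. UNCONDITIONAL.
[cite: DumerKovalevPryadko2015, Thm 2 (y = 0) with eq. (succesful-decoding-depolarizing)] -/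
theorem css_depolarizing_isThresholdLowerBound_of_rowWeight [∀ i, Fintype (Q i)] [∀ i, DecidableEq (Q i)]
    [∀ i, Fintype (RX i)] [∀ i, Fintype (RZ i)] (C : ∀ i, CSSCode (RX i) (RZ i) (Q i))
    (DX : ∀ i, Decoder (RZ i → ZMod 2) (Q i → ZMod 2)) (DZ : ∀ i, Decoder (RX i → ZMod 2) (Q i → ZMod 2))
    (hDX : ∀ i, (DX i).IsMinWeight (C i).xSyndrome ((C i).kerZ : Set (Q i → ZMod 2)) hammingNorm)
    (hDZ : ∀ i, (DZ i).IsMinWeight (C i).zSyndrome ((C i).kerX : Set (Q i → ZMod 2)) hammingNorm)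
    {w : ℕ} (hw : 2 ≤ w) (hrowX : ∀ i x, (rowSupp (C i).HX x).card ≤ w)
    (hrowZ : ∀ i x, (rowSupp (C i).HZ x).card ≤ w) (d : ℕ → ℕ) (hd1 : ∀ i, 1 ≤ d i)
    (hdZ : ∀ i (x : Q i → ZMod 2), (C i).HX *ᵥ x = 0 → x ∉ (C i).rowSpZ → d i ≤ hammingNorm x)
    (hdX : ∀ i (x : Q i → ZMod 2), (C i).HZ *ᵥ x = 0 → x ∉ (C i).rowSpX → d i ≤ hammingNorm x)
    (hgrowth : ∀ r : ℝ, 0 < r → r < 1 →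
      Tendsto (fun i => (Fintype.card (Q i) : ℝ) * r ^ d i) atTop (𝓝 0)) :
    IsThresholdLowerBound (depolarizingFailureFamily C DX DZ) (3 / 2 * thresholdValue ((w - 1 : ℕ) : ℝ)) := by
  have h := depolarizing_isThresholdLowerBound C DX DZ
    (x_isThresholdLowerBound_of_rowWeight C DX hDX hw hrowZ d hd1 hdX hgrowth)
    (z_isThresholdLowerBound_of_rowWeight C DZ hDZ hw hrowX d hd1 hdZ hgrowth)
    ((min_le_left _ _).trans (thresholdValue_le_two_thirds _))
  rwa [min_self] at h

/-! ### The toric codes as hypergraph products: `(3/2)·p₀(3)`, unconditional -/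

/-- **Depolarizing threshold `≥ (3/2)·p₀(3) = (3-2√2)/4 ≈ .0429` for the toric codes `HGP(circ_L, circ_L)`**,
decoded sector-wise by ANY pair of minimum-weight decoder families. UNCONDITIONAL.
[cite: DennisEtAl2002, §4.1 (depolarizing channel; X and Z errors corrected separately)] -/
theorem toricHGP_depolarizing_isThresholdLowerBound
    (DX : ∀ k, Decoder ((Fin (k + 2) × Fin (k + 2)) → ZMod 2)
      (((Fin (k + 2) × Fin (k + 2)) ⊕ (Fin (k + 2) × Fin (k + 2))) → ZMod 2))
    (DZ : ∀ k, Decoder ((Fin (k + 2) × Fin (k + 2)) → ZMod 2)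
      (((Fin (k + 2) × Fin (k + 2)) ⊕ (Fin (k + 2) × Fin (k + 2))) → ZMod 2))
    (hDX : ∀ k, (DX k).IsMinWeight (toricHGPCode k).xSyndrome ((toricHGPCode k).kerZ : Set _) hammingNorm)
    (hDZ : ∀ k, (DZ k).IsMinWeight (toricHGPCode k).zSyndrome ((toricHGPCode k).kerX : Set _) hammingNorm) :
    IsThresholdLowerBound (depolarizingFailureFamily (fun k => toricHGPCode k) DX DZ)
      (3 / 2 * thresholdValue 3) := by
  have h := depolarizing_isThresholdLowerBound (fun k => toricHGPCode k) DX DZ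
    (toricHGP_x_isThresholdLowerBound DX hDX) (toricHGP_z_isThresholdLowerBound DZ hDZ)
    ((min_le_left _ _).trans (thresholdValue_le_two_thirds _))
  rwa [min_self] at h

/-- Canonical instance: minimum-weight decoding of both syndromes of the toric codes `HGP(circ_L, circ_L)` has
depolarizing threshold `≥ (3/2)·p₀(3)`. [cite: DennisEtAl2002, §4.1] -/
theorem toricHGP_depolarizing_isThresholdLowerBound_minWeight :
    IsThresholdLowerBound
      (depolarizingFailureFamily (fun k => toricHGPCode k)
        (fun k => Decoder.minWeight (toricHGPCode k).xSyndrome hammingNorm)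
        fun k => Decoder.minWeight (toricHGPCode k).zSyndrome hammingNorm)
      (3 / 2 * thresholdValue 3) :=
  toricHGP_depolarizing_isThresholdLowerBound _ _ (fun k => (toricHGPCode k).isMinWeight_minWeight_xSyndrome)
    fun k => (toricHGPCode k).isMinWeight_minWeight_zSyndrome

/-- **`p_c^depol > .0427`** (decimal, kernel) for the toric codes as hypergraph products under sector-wise
minimum-weight decoding (`(3/2)·p₀(3) ≈ .04289`). [cite: DennisEtAl2002, §4.1 and §5.3] -/
theorem toricHGP_depolarizing_accuracyThreshold_gt
    (DX : ∀ k, Decoder ((Fin (k + 2) × Fin (k + 2)) → ZMod 2)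
      (((Fin (k + 2) × Fin (k + 2)) ⊕ (Fin (k + 2) × Fin (k + 2))) → ZMod 2))
    (DZ : ∀ k, Decoder ((Fin (k + 2) × Fin (k + 2)) → ZMod 2)
      (((Fin (k + 2) × Fin (k + 2)) ⊕ (Fin (k + 2) × Fin (k + 2))) → ZMod 2))
    (hDX : ∀ k, (DX k).IsMinWeight (toricHGPCode k).xSyndrome ((toricHGPCode k).kerZ : Set _) hammingNorm)
    (hDZ : ∀ k, (DZ k).IsMinWeight (toricHGPCode k).zSyndrome ((toricHGPCode k).kerX : Set _) hammingNorm) :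
    (0.0427 : ℝ) < accuracyThreshold (depolarizingFailureFamily (fun k => toricHGPCode k) DX DZ) := by
  have h3 := thresholdValue_three_bounds.1
  refine lt_of_lt_of_le (by linarith) (le_accuracyThreshold (toricHGP_depolarizing_isThresholdLowerBound DX DZ hDX hDZ) ?_)
  have := thresholdValue_le_half (3 : ℝ)
  linarith

/-! ### The `(3,4)`-Gallager hypergraph-product class: `(3/2)·p₀(6)` -/

section Family

variable {m₁ n₁ m₂ n₂ : ℕ → ℕ}

/-- **Depolarizing threshold `≥ (3/2)·p₀(6) ≈ .0105` for hypergraph products of `(3,4)`-bounded seeds**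
(census class B.1 / B1gal), sector-wise minimum-weight decoding, under the family growth hypotheses of
`gallager34_z|x_isThresholdLowerBound` (both sector distance sequences). UNCONDITIONAL modulo those hypotheses.
[cite: DumerKovalevPryadko2015, Thm 2 (y = 0, w = 7) with eq. (succesful-decoding-depolarizing)] -/
theorem gallager34_depolarizing_isThresholdLowerBound (H₁ : ∀ i, Matrix (Fin (m₁ i)) (Fin (n₁ i)) (ZMod 2))
    (H₂ : ∀ i, Matrix (Fin (m₂ i)) (Fin (n₂ i)) (ZMod 2))
    (hB₁ : ∀ i, IsDegreeBounded (H₁ i) 3 4) (hB₂ : ∀ i, IsDegreeBounded (H₂ i) 3 4)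
    (DX : ∀ i, Decoder ((Fin (n₁ i) × Fin (m₂ i)) → ZMod 2)
      (((Fin (n₁ i) × Fin (n₂ i)) ⊕ (Fin (m₁ i) × Fin (m₂ i))) → ZMod 2))
    (DZ : ∀ i, Decoder ((Fin (m₁ i) × Fin (n₂ i)) → ZMod 2)
      (((Fin (n₁ i) × Fin (n₂ i)) ⊕ (Fin (m₁ i) × Fin (m₂ i))) → ZMod 2))
    (hDX : ∀ i, (DX i).IsMinWeight (HGP.code (H₁ i) (H₂ i)).xSyndrome
      ((HGP.code (H₁ i) (H₂ i)).kerZ : Set _) hammingNorm)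
    (hDZ : ∀ i, (DZ i).IsMinWeight (HGP.code (H₁ i) (H₂ i)).zSyndrome
      ((HGP.code (H₁ i) (H₂ i)).kerX : Set _) hammingNorm)
    (d : ℕ → ℕ) (hd1 : ∀ i, 1 ≤ d i)
    (hd₁ : ∀ i, (d i : ℕ∞) ≤ minDist (pcCode (H₁ i))) (hd₁t : ∀ i, (d i : ℕ∞) ≤ minDist (pcCode (H₁ i)ᵀ))
    (hd₂ : ∀ i, (d i : ℕ∞) ≤ minDist (pcCode (H₂ i))) (hd₂t : ∀ i, (d i : ℕ∞) ≤ minDist (pcCode (H₂ i)ᵀ))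
    (hgrowth : ∀ r : ℝ, 0 < r → r < 1 →
      Tendsto (fun i => ((n₁ i * n₂ i + m₁ i * m₂ i : ℕ) : ℝ) * r ^ d i) atTop (𝓝 0)) :
    IsThresholdLowerBound (depolarizingFailureFamily (fun i => HGP.code (H₁ i) (H₂ i)) DX DZ)
      (3 / 2 * thresholdValue 6) := by
  have h := depolarizing_isThresholdLowerBound (fun i => HGP.code (H₁ i) (H₂ i)) DX DZ
    (gallager34_x_isThresholdLowerBound H₁ H₂ hB₁ hB₂ DX hDX d hd1 hd₁t hd₂ hgrowth)
    (gallager34_z_isThresholdLowerBound H₁ H₂ hB₁ hB₂ DZ hDZ d hd1 hd₁ hd₂t hgrowth)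
    ((min_le_left _ _).trans (thresholdValue_le_two_thirds _))
  rwa [min_self] at h

/-- **`p_c^depol > .0103`** (decimal) for the `(3,4)`-Gallager HGP class as above (`(3/2)·p₀(6) ≈ .01049`).
[cite: DumerKovalevPryadko2015, Thm 2 (y = 0, w = 7)] -/
theorem gallager34_depolarizing_accuracyThreshold_gt (H₁ : ∀ i, Matrix (Fin (m₁ i)) (Fin (n₁ i)) (ZMod 2))
    (H₂ : ∀ i, Matrix (Fin (m₂ i)) (Fin (n₂ i)) (ZMod 2))
    (hB₁ : ∀ i, IsDegreeBounded (H₁ i) 3 4) (hB₂ : ∀ i, IsDegreeBounded (H₂ i) 3 4)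
    (DX : ∀ i, Decoder ((Fin (n₁ i) × Fin (m₂ i)) → ZMod 2)
      (((Fin (n₁ i) × Fin (n₂ i)) ⊕ (Fin (m₁ i) × Fin (m₂ i))) → ZMod 2))
    (DZ : ∀ i, Decoder ((Fin (m₁ i) × Fin (n₂ i)) → ZMod 2)
      (((Fin (n₁ i) × Fin (n₂ i)) ⊕ (Fin (m₁ i) × Fin (m₂ i))) → ZMod 2))
    (hDX : ∀ i, (DX i).IsMinWeight (HGP.code (H₁ i) (H₂ i)).xSyndrome
      ((HGP.code (H₁ i) (H₂ i)).kerZ : Set _) hammingNorm)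
    (hDZ : ∀ i, (DZ i).IsMinWeight (HGP.code (H₁ i) (H₂ i)).zSyndrome
      ((HGP.code (H₁ i) (H₂ i)).kerX : Set _) hammingNorm)
    (d : ℕ → ℕ) (hd1 : ∀ i, 1 ≤ d i)
    (hd₁ : ∀ i, (d i : ℕ∞) ≤ minDist (pcCode (H₁ i))) (hd₁t : ∀ i, (d i : ℕ∞) ≤ minDist (pcCode (H₁ i)ᵀ))
    (hd₂ : ∀ i, (d i : ℕ∞) ≤ minDist (pcCode (H₂ i))) (hd₂t : ∀ i, (d i : ℕ∞) ≤ minDist (pcCode (H₂ i)ᵀ))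
    (hgrowth : ∀ r : ℝ, 0 < r → r < 1 →
      Tendsto (fun i => ((n₁ i * n₂ i + m₁ i * m₂ i : ℕ) : ℝ) * r ^ d i) atTop (𝓝 0)) :
    (0.0103 : ℝ) < accuracyThreshold (depolarizingFailureFamily (fun i => HGP.code (H₁ i) (H₂ i)) DX DZ) := by
  have h6 := thresholdValue_six_bounds.1
  refine lt_of_lt_of_le (by linarith) (le_accuracyThreshold
    (gallager34_depolarizing_isThresholdLowerBound H₁ H₂ hB₁ hB₂ DX DZ hDX hDZ d hd1 hd₁ hd₁t hd₂ hd₂t hgrowth) ?_)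
  have := thresholdValue_le_half (6 : ℝ)
  linarith

end Family

end Summit.Ventures.QEC.Thresholds
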